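import Mathlib
import HarnessLib
import Literature.Probability.MarkovChains.DoeblinMinorization

/-!
# The transition operator of a Markov kernel on bounded observables; the residual kernel of a
# Doeblin minorisation by the invariant law carries the centred observables

HONEST FRAMING: exact (Metropolis-corrected) sampling algorithms for lattice gauge theory;
figures of merit are autocorrelation/cost numbers at stated couplings and volumes; no
continuum-physics claim.

Venture `LatticeQCDFlow` (cell pub-lqcd), topic `Scoring`; FANOUT row 8 (`s0-cpn-nemc`, GEN-10).
NEW WORK of the cell (bookkeeping over Mathlib's `ProbabilityTheory.Kernel`, `Kernel.Invariant`,
Bochner integrals), not a published result; the general-state-space groundwork for the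
autocorrelation envelope `Scoring/DoeblinAutocorrelation.lean` (the kernel form of the finite-state
`Scoring/IMHAutocorrelationEnvelope.lean`).  The only published input is the residual kernel of the
tree's formalisation of Doeblin's theorem
(`Literature.Probability.MarkovChains.Doeblin.residualKernel`, Meyn–Tweedie 1993 Thm 16.2.4), used
through its splitting `K(x,·) = ε π + (1 − ε) R(x,·)` (`apply_eq_add_residual`,
`bind_eq_add_residual`); nothing is restated.

## Content (`κ` a Markov kernel on a measurable space `Ω`; observables `g : Ω → ℝ` bounded and
## measurable)

* `kop κ g x = ∫ g d(κ x)` — the transition operator on observables; `autocov κ π f t =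
  ∫ f · (kop κ)^[t] f dπ` — the stationary lag-`t` second moment `E_π[f(X_0) f(X_t)]` (the
  autocovariance `C_f(t)` when `π(f) = 0`).
* `integrable_of_bounded`, `abs_kop_le`, `measurable_kop`, `iterate_kop_bounded_measurable`,
  `kop_const_mul` — `kop` preserves bounds, measurability, is homogeneous; `kop_comp` —
  Chapman–Kolmogorov `kop (η ∘ₖ κ) = kop κ ∘ kop η` (so `(kop κ)^[t]` is the `t`-step operator);
  **`integral_kop`** / `integral_iterate_kop` — INVARIANCE ON OBSERVABLES: `∫ kop κ g dπ = ∫ g dπ`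
  for `π` invariant (`Kernel.Invariant κ π`).
* Doeblin by the invariant law (`κ(x, B) ≥ ε π(B)`, `ε < 1`, `R` the Literature residual kernel):
  `kernel_eq_add_residual` (as measures), `kop_eq_add_residual`
  (`kop κ g = ε π(g) + (1 − ε) kop R g`), **`invariant_residualKernel`** (`π R = π`, by cancellation
  in `π = ε π + (1 − ε) π R`), `kop_eq_of_centred`, **`iterate_kop_eq_of_centred`**: on a
  `π`-CENTRED observable the chain acts through the residual alone,
  `(kop κ)^[t] f = (1 − ε)ᵗ · (kop R)^[t] f`.
* `sq_integral_le_integral_sq` — JENSEN for a probability law, `(∫ g)² ≤ ∫ g²`;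
  `sq_integral_mul_le` — CAUCHY–SCHWARZ `(∫ f u)² ≤ (∫ f²)(∫ u²)` for bounded measurable `f, u`
  (discriminant of `s ↦ ∫ (s f − u)² ≥ 0`).
-/


noncomputable section

namespace Summit.Ventures.LatticeQCDFlow.Scoring

open MeasureTheory ProbabilityTheory Filter Literature.Probability.MarkovChains
open scoped ENNReal

variable {Ω : Type*} [MeasurableSpace Ω]

/-! ### The transition operator on bounded observables -/

/-- The transition operator of a kernel on observables: `(kop κ g)(x) = ∫ g d(κ x)`. -/
def kop (κ : Kernel Ω Ω) (g : Ω → ℝ) : Ω → ℝ := fun x => ∫ y, g y ∂(κ x)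

/-- The stationary lag-`t` second moment `E_π[f(X_0) · f(X_t)] = ∫ f · (kop κ)^[t] f dπ` (the
autocovariance `C_f(t)` when `π(f) = 0`). -/
def autocov (κ : Kernel Ω Ω) (π : Measure Ω) (f : Ω → ℝ) (t : ℕ) : ℝ :=
  ∫ x, f x * (kop κ)^[t] f x ∂π

section Operator

variable (κ : Kernel Ω Ω) [IsMarkovKernel κ]

/-- A bounded measurable observable is integrable against every probability law. -/
theorem integrable_of_bounded (μ : Measure Ω) [IsFiniteMeasure μ] {g : Ω → ℝ} (hg : Measurable g)
    {C : ℝ} (hC : ∀ x, |g x| ≤ C) : Integrable g μ :=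
  (integrable_const C).mono' hg.aestronglyMeasurable (Eventually.of_forall fun x => by
    rw [Real.norm_eq_abs]; exact hC x)

/-- `kop` preserves a uniform bound. -/
theorem abs_kop_le {g : Ω → ℝ} {C : ℝ} (hC : ∀ x, |g x| ≤ C) (x : Ω) : |kop κ g x| ≤ C := by
  have hC0 : 0 ≤ C := (abs_nonneg _).trans (hC x)
  unfold kop
  calc |∫ y, g y ∂(κ x)| = ‖∫ y, g y ∂(κ x)‖ := (Real.norm_eq_abs _).symm
    _ ≤ C * (κ x).real Set.univ := norm_integral_le_of_norm_le_const (Eventually.of_forall fun y => by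
        rw [Real.norm_eq_abs]; exact hC y)
    _ = C := by rw [probReal_univ, mul_one]

omit [IsMarkovKernel κ] in
/-- `kop` preserves measurability. -/
theorem measurable_kop {g : Ω → ℝ} (hg : Measurable g) : Measurable (kop κ g) :=
  (hg.stronglyMeasurable.integral_kernel (κ := κ)).measurable

omit [IsMarkovKernel κ] in
/-- **Invariance on observables**: `∫ kop κ g dπ = ∫ g dπ` for `π` invariant and `g` bounded
measurable. -/
theorem integral_kop {π : Measure Ω} [IsProbabilityMeasure π] (hπ : Kernel.Invariant κ π)
    {g : Ω → ℝ} (hg : Measurable g) {C : ℝ} (hC : ∀ x, |g x| ≤ C) :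
    ∫ x, kop κ g x ∂π = ∫ x, g x ∂π := by
  have hint : Integrable g (κ ∘ₘ π) := by
    have h : κ ∘ₘ π = π := hπ.def
    rw [h]
    exact integrable_of_bounded π hg hC
  have h1 : ∫ y, g y ∂(κ ∘ₘ π) = ∫ x, ∫ y, g y ∂(κ x) ∂π := by
    rw [Measure.comp_eq_comp_const_apply] at hint ⊢
    rw [Kernel.integral_comp hint, Kernel.const_apply]
  have h2 : (κ ∘ₘ π) = π := hπ.def
  rw [h2] at h1
  rw [h1]
  rfl

/-- Chapman–Kolmogorov on observables: `kop (η ∘ₖ κ) g = kop κ (kop η g)` for bounded measurable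
`g` — so `(kop κ)^[t]` is the transition operator of the `t`-step kernel. -/
theorem kop_comp (η : Kernel Ω Ω) [IsMarkovKernel η] {g : Ω → ℝ} (hg : Measurable g) {C : ℝ}
    (hC : ∀ x, |g x| ≤ C) : kop (η ∘ₖ κ) g = kop κ (kop η g) := by
  funext x
  unfold kop
  exact Kernel.integral_comp (integrable_of_bounded _ hg hC)

/-- Iterates of `kop` stay bounded and measurable. -/
theorem iterate_kop_bounded_measurable {g : Ω → ℝ} (hg : Measurable g) {C : ℝ}
    (hC : ∀ x, |g x| ≤ C) : ∀ t : ℕ,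
    Measurable ((kop κ)^[t] g) ∧ ∀ x, |(kop κ)^[t] g x| ≤ C := by
  intro t
  induction t with
  | zero => exact ⟨hg, hC⟩
  | succ t ih =>
    rw [Function.iterate_succ_apply']
    exact ⟨measurable_kop κ ih.1, abs_kop_le κ ih.2⟩

/-- … and keep the `π`-mean (invariance, iterated). -/
theorem integral_iterate_kop {π : Measure Ω} [IsProbabilityMeasure π] (hπ : Kernel.Invariant κ π)
    {g : Ω → ℝ} (hg : Measurable g) {C : ℝ} (hC : ∀ x, |g x| ≤ C) :
    ∀ t : ℕ, ∫ x, (kop κ)^[t] g x ∂π = ∫ x, g x ∂π := by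
  intro t
  induction t with
  | zero => rfl
  | succ t ih =>
    obtain ⟨hm, hb⟩ := iterate_kop_bounded_measurable κ hg hC t
    rw [Function.iterate_succ_apply', integral_kop κ hπ hm hb, ih]

omit [IsMarkovKernel κ] in
/-- `kop` is homogeneous: `kop κ (a · g) = a · kop κ g`. -/
theorem kop_const_mul (a : ℝ) (g : Ω → ℝ) :
    kop κ (fun x => a * g x) = fun x => a * kop κ g x := by
  funext x
  unfold kop
  exact integral_const_mul a _

end Operator

/-! ### Doeblin by the invariant law: the residual kernel carries the centred observables -/

section Residual

variable {κ : Kernel Ω Ω} [IsMarkovKernel κ] {π : Measure Ω} [IsProbabilityMeasure π] {ε : ℝ≥0∞}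
  {hmin : ∀ x {B : Set Ω}, MeasurableSet B → ε * π B ≤ κ x B}

/-- The splitting `κ x = ε π + (1 − ε) R x` of the Literature file, as an identity of measures. -/
theorem kernel_eq_add_residual (hε : ε < 1) (x : Ω) :
    κ x = ε • π + (1 - ε) • Doeblin.residualKernel κ π ε hmin x := by
  ext A hA
  rw [Measure.add_apply, Measure.smul_apply, Measure.smul_apply, smul_eq_mul, smul_eq_mul]
  exact Doeblin.apply_eq_add_residual hε x hA

/-- … and on observables: `kop κ g = ε π(g) + (1 − ε) kop R g` (bounded measurable `g`). -/
theorem kop_eq_add_residual (hε : ε < 1) {g : Ω → ℝ} (hg : Measurable g) {C : ℝ}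
    (hC : ∀ x, |g x| ≤ C) (x : Ω) :
    kop κ g x = ε.toReal * ∫ y, g y ∂π
      + (1 - ε).toReal * kop (Doeblin.residualKernel κ π ε hmin) g x := by
  haveI := Doeblin.isMarkovKernel_residualKernel (κ := κ) (ν := π) (hmin := hmin) hε
  have h1 : Integrable g (ε • π) := (integrable_of_bounded π hg hC).smul_measure (ne_top_of_lt hε)
  have h2 : Integrable g ((1 - ε) • Doeblin.residualKernel κ π ε hmin x) :=
    (integrable_of_bounded _ hg hC).smul_measure
      (ne_top_of_le_ne_top ENNReal.one_ne_top tsub_le_self)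
  unfold kop
  rw [kernel_eq_add_residual (κ := κ) (π := π) (hmin := hmin) hε x, integral_add_measure h1 h2,
    integral_smul_measure, integral_smul_measure, smul_eq_mul, smul_eq_mul]

/-- **The residual kernel leaves `π` invariant** (`π = ε π + (1 − ε) π R` and cancellation). -/
theorem invariant_residualKernel (hπ : Kernel.Invariant κ π) (hε : ε < 1) :
    Kernel.Invariant (Doeblin.residualKernel κ π ε hmin) π := by
  haveI := Doeblin.isMarkovKernel_residualKernel (κ := κ) (ν := π) (hmin := hmin) hε
  have h := Doeblin.bind_eq_add_residual (κ := κ) (ν := π) (hmin := hmin) hε π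
  rw [hπ.def] at h
  change π.bind _ = π
  ext A hA
  have hA' : π A = ε * π A + (1 - ε) * (π.bind (Doeblin.residualKernel κ π ε hmin)) A := by
    have := congrArg (fun m : Measure Ω => m A) h
    simpa only [Measure.add_apply, Measure.smul_apply, smul_eq_mul] using this
  have hsplit : π A = ε * π A + (1 - ε) * π A := by
    rw [← add_mul, add_tsub_cancel_of_le hε.le, one_mul]
  have h1 : 1 - ε ≠ 0 := (tsub_pos_of_lt hε).ne'
  have h2 : 1 - ε ≠ ⊤ := ne_top_of_le_ne_top ENNReal.one_ne_top tsub_le_self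
  have hfin : ε * π A ≠ ⊤ := ENNReal.mul_ne_top (ne_top_of_lt hε) (measure_ne_top π A)
  have key := hA'.symm.trans hsplit
  exact (ENNReal.mul_right_inj h1 h2).1 ((ENNReal.add_right_inj hfin).1 key)

/-- On a `π`-CENTRED bounded measurable observable the chain acts through the residual alone:
`kop κ g = (1 − ε) · kop R g`. -/
theorem kop_eq_of_centred (hε : ε < 1) {g : Ω → ℝ} (hg : Measurable g) {C : ℝ}
    (hC : ∀ x, |g x| ≤ C) (hg0 : ∫ x, g x ∂π = 0) (x : Ω) :
    kop κ g x = (1 - ε).toReal * kop (Doeblin.residualKernel κ π ε hmin) g x := by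
  rw [kop_eq_add_residual (κ := κ) (π := π) (hmin := hmin) hε hg hC x, hg0, mul_zero, zero_add]

/-- **`(kop κ)^[t] f = (1 − ε)ᵗ · (kop R)^[t] f`** for a `π`-centred bounded measurable `f` (the
rank-one part kills centred observables at every intermediate time because `π R = π`). -/
theorem iterate_kop_eq_of_centred (hπ : Kernel.Invariant κ π) (hε : ε < 1) {f : Ω → ℝ}
    (hf : Measurable f) {C : ℝ} (hC : ∀ x, |f x| ≤ C) (hf0 : ∫ x, f x ∂π = 0) :
    ∀ t : ℕ, (kop κ)^[t] f
      = fun x => (1 - ε).toReal ^ t * (kop (Doeblin.residualKernel κ π ε hmin))^[t] f x := by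
  haveI := Doeblin.isMarkovKernel_residualKernel (κ := κ) (ν := π) (hmin := hmin) hε
  intro t
  induction t with
  | zero => funext x; simp
  | succ t ih =>
    obtain ⟨hm, hb⟩ :=
      iterate_kop_bounded_measurable (Doeblin.residualKernel κ π ε hmin) hf hC t
    have h0 : ∫ x, (kop (Doeblin.residualKernel κ π ε hmin))^[t] f x ∂π = 0 := by
      rw [integral_iterate_kop _ (invariant_residualKernel hπ hε) hf hC t, hf0]
    rw [Function.iterate_succ_apply', ih, kop_const_mul, Function.iterate_succ_apply']
    funext x
    rw [kop_eq_of_centred (κ := κ) (π := π) (hmin := hmin) hε hm hb h0 x]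
    ring

end Residual

/-! ### Jensen and Cauchy–Schwarz for bounded observables -/

section Inequalities

/-- JENSEN for a probability law: `(∫ g dμ)² ≤ ∫ g² dμ` (the variance is nonnegative). -/
theorem sq_integral_le_integral_sq (μ : Measure Ω) [IsProbabilityMeasure μ] {g : Ω → ℝ}
    (hg : Measurable g) {C : ℝ} (hC : ∀ x, |g x| ≤ C) :
    (∫ x, g x ∂μ) ^ 2 ≤ ∫ x, g x ^ 2 ∂μ := by
  have hint : Integrable g μ := integrable_of_bounded μ hg hC
  have hint2 : Integrable (fun x => g x ^ 2) μ :=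
    integrable_of_bounded μ (hg.pow_const 2) (C := C ^ 2) fun x => by
      rw [abs_pow]; exact pow_le_pow_left₀ (abs_nonneg _) (hC x) 2
  have h0 : 0 ≤ ∫ x, (g x - ∫ y, g y ∂μ) ^ 2 ∂μ := integral_nonneg fun x => sq_nonneg _
  have hexp : ∫ x, (g x - ∫ y, g y ∂μ) ^ 2 ∂μ = ∫ x, g x ^ 2 ∂μ - (∫ y, g y ∂μ) ^ 2 := by
    have h : (fun x => (g x - ∫ y, g y ∂μ) ^ 2)
        = fun x => g x ^ 2 - (2 * ∫ y, g y ∂μ) * g x + (∫ y, g y ∂μ) ^ 2 := by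
      funext x; ring
    rw [h, integral_add ?_ (integrable_const _), integral_sub hint2 (hint.const_mul _),
      integral_const_mul, integral_const, probReal_univ, one_smul]
    · ring
    · exact hint2.sub (hint.const_mul _)
  linarith

/-- CAUCHY–SCHWARZ in `L²(μ)` for bounded measurable observables:
`(∫ f u dμ)² ≤ (∫ f² dμ)(∫ u² dμ)` (discriminant of `s ↦ ∫ (s f − u)² ≥ 0`). -/
theorem sq_integral_mul_le (μ : Measure Ω) [IsFiniteMeasure μ] {f u : Ω → ℝ} (hf : Measurable f)
    (hu : Measurable u) {Cf Cu : ℝ} (hCf : ∀ x, |f x| ≤ Cf) (hCu : ∀ x, |u x| ≤ Cu) :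
    (∫ x, f x * u x ∂μ) ^ 2 ≤ (∫ x, f x ^ 2 ∂μ) * ∫ x, u x ^ 2 ∂μ := by
  have hf2 : Integrable (fun x => f x ^ 2) μ :=
    integrable_of_bounded μ (hf.pow_const 2) (C := Cf ^ 2) fun x => by
      rw [abs_pow]; exact pow_le_pow_left₀ (abs_nonneg _) (hCf x) 2
  have hu2 : Integrable (fun x => u x ^ 2) μ :=
    integrable_of_bounded μ (hu.pow_const 2) (C := Cu ^ 2) fun x => by
      rw [abs_pow]; exact pow_le_pow_left₀ (abs_nonneg _) (hCu x) 2
  have hfu : Integrable (fun x => f x * u x) μ :=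
    integrable_of_bounded μ (hf.mul hu) (C := Cf * Cu) fun x => by
      rw [abs_mul]
      exact mul_le_mul (hCf x) (hCu x) (abs_nonneg _) ((abs_nonneg _).trans (hCf x))
  have key : ∀ s : ℝ, 0 ≤ (∫ x, f x ^ 2 ∂μ) * (s * s) + (-2 * ∫ x, f x * u x ∂μ) * s
      + ∫ x, u x ^ 2 ∂μ := by
    intro s
    have h0 : 0 ≤ ∫ x, (s * f x - u x) ^ 2 ∂μ := integral_nonneg fun x => sq_nonneg _
    have h : (fun x => (s * f x - u x) ^ 2)
        = fun x => (s * s) * f x ^ 2 - (2 * s) * (f x * u x) + u x ^ 2 := by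
      funext x; ring
    rw [h, integral_add ?_ hu2, integral_sub (hf2.const_mul _) (hfu.const_mul _),
      integral_const_mul, integral_const_mul] at h0
    · linarith
    · exact (hf2.const_mul _).sub (hfu.const_mul _)
  have hd := discrim_le_zero key
  unfold discrim at hd
  nlinarith [hd]

end Inequalities

end Summit.Ventures.LatticeQCDFlow.Scoring

end
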